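import Mathlib

/-!
# F3 — HECKE RIGIDITY kernel: d'Alembert's functional equation on a finite abelian group — pub-rhpf fake-3 (gen 4)

HONEST FRAMING: mechanism/rigidity campaign; no RH claims.

KERNEL FACT (this file, sorry-free): let `α` be a finite abelian group (additive notation) and
`g : α → ℂ` a function, not identically zero, satisfying D'ALEMBERT'S EQUATION
`g (x + y) + g (x - y) = g x * g y` for all `x y`.  Then there is a character `ψ : AddChar α ℂ` with
`g x = ψ x + ψ (-x)` for every `x` (`exists_addChar_of_dAlembert`); conversely every `ψ + ψ ∘ neg`
solves the equation (`dAlembert_addChar`), and every non-zero solution has `g 0 = 2`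
(`dAlembert_apply_zero`).  Proof: expand `g` in the character basis of `α → ℂ`
(Mathlib `AddChar.complexBasis`); for fixed `y` both sides of the equation are functions of `x` whose
coefficients at `ψ` are `c ψ * (ψ y + ψ (-y))` and `c ψ * g y`; comparing them at a `ψ₀` with
`c ψ₀ ≠ 0` gives `g y = ψ₀ y + ψ₀ (-y)`.  A multiplicative-notation wrapper for `CommGroup`s
(`exists_hom_of_dAlembert_mul`) is included because ideal class groups are written multiplicatively.

WHY fake-3 FILES IT (documentation only; nothing below is used by the kernel facts).  THEOREM F3-C
(FAKES §3.9, PROVED-elementary ∘ this kernel): let `K` be an imaginary quadratic field with class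
group `G`, and for `f : G → ℂ` with `f e = 1` put `F_f(s) = Σ_𝔞 f [𝔞] N𝔞^{-s} = Σ_ψ f̂(ψ) L(s, ψ)` —
the FE-HONEST PENCIL of `ζ_K` (every member has `ζ_K`'s completed functional equation).  Writing
`g = f + f ∘ inv` one has, at split primes `p ≠ q` with prime classes `C_p, C_q`:
`a(p) = g C_p`, `a(p²) = g (C_p²) + 1`, `a(pq) = g (C_p C_q) + g (C_p C_q⁻¹)`; so the degree-2 HECKE
RELATIONS `a(p²) = a(p)² - χ_d(p)` and `a(pq) = a(p) a(q)` are EXACTLY d'Alembert's equation for `g` at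
the pairs `(C_p, C_p)` and `(C_p, C_q)`; every class contains split primes (Chebotarev), hence a
Hecke-consistent member of the pencil has `g = ψ + ψ̄`, i.e. `F_f = L(s, ψ)` is a genuine Hecke
`L`-function.  The EFFECTIVE depth at which this bites (`X_rig(d)`, and `n_H(Z_d) = P″(d)²` for the
principal twin) is DATA / PROVED-elementary in FAKES §3.9; none of it is asserted here.
-/

set_option linter.dupNamespace false

noncomputable section

open scoped BigOperators

namespace Summit.RiemannHypothesis.RiemannHypothesis.Theorems.PfPersistenceBarrier.F3Hecke

open AddChar

variable {α : Type*} [AddCommGroup α]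

/-- Every character sum `ψ + ψ ∘ neg` solves d'Alembert's equation. [folklore] -/
theorem dAlembert_addChar (ψ : AddChar α ℂ) (x y : α) :
    (ψ (x + y) + ψ (-(x + y))) + (ψ (x - y) + ψ (-(x - y))) =
      (ψ x + ψ (-x)) * (ψ y + ψ (-y)) := by
  simp only [sub_eq_add_neg, neg_add, neg_neg, map_add_eq_mul]
  ring

variable [Finite α]

/-- Expansion of any `g : α → ℂ` in the character basis (Mathlib `AddChar.complexBasis`). [folklore] -/
theorem eq_sum_complexBasis_coord (g : α → ℂ) (x : α) :
    haveI := Fintype.ofFinite α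
    g x = ∑ ψ : AddChar α ℂ, (AddChar.complexBasis α).equivFun g ψ * ψ x := by
  classical
  have h := congr_fun ((AddChar.complexBasis α).sum_equivFun g) x
  rw [Finset.sum_apply] at h
  simp only [Pi.smul_apply, smul_eq_mul, AddChar.complexBasis_apply] at h
  convert h.symm using 1

/-- **d'Alembert's functional equation on a finite abelian group.**  A function `g : α → ℂ`, not
identically zero, with `g (x + y) + g (x - y) = g x * g y` for all `x, y` is a character sum:
`g = ψ + ψ ∘ neg` for some `ψ : AddChar α ℂ`. [folklore] -/
theorem exists_addChar_of_dAlembert (g : α → ℂ) (h0 : ∃ a, g a ≠ 0)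
    (h : ∀ x y, g (x + y) + g (x - y) = g x * g y) :
    ∃ ψ : AddChar α ℂ, ∀ x, g x = ψ x + ψ (-x) := by
  classical
  letI := Fintype.ofFinite α
  set b := AddChar.complexBasis α with hb
  set c : AddChar α ℂ → ℂ := fun ψ => b.equivFun g ψ with hc
  have hg : ∀ x, g x = ∑ ψ : AddChar α ℂ, c ψ * ψ x := by
    intro x
    have := eq_sum_complexBasis_coord g x
    convert this using 1
  -- some coordinate is non-zero
  obtain ⟨ψ₀, hψ₀⟩ : ∃ ψ, c ψ ≠ 0 := by
    by_contra! hzero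
    obtain ⟨a, ha⟩ := h0
    apply ha
    rw [hg a]
    exact Finset.sum_eq_zero (fun ψ _ => by rw [hzero ψ, zero_mul])
  refine ⟨ψ₀, fun y => ?_⟩
  -- compare the coordinates of `x ↦ g (x + y) + g (x - y)` and `x ↦ g x * g y`
  have key : (fun ψ : AddChar α ℂ => c ψ * (ψ y + ψ (-y))) = (fun ψ => c ψ * g y) := by
    apply b.equivFun.symm.injective
    funext x
    rw [Module.Basis.equivFun_symm_apply, Module.Basis.equivFun_symm_apply, Finset.sum_apply, Finset.sum_apply]
    simp only [Pi.smul_apply, smul_eq_mul, hb, AddChar.complexBasis_apply]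
    have lhs : ∑ ψ : AddChar α ℂ, c ψ * (ψ y + ψ (-y)) * ψ x = g (x + y) + g (x - y) := by
      rw [hg (x + y), hg (x - y), ← Finset.sum_add_distrib]
      refine Finset.sum_congr rfl (fun ψ _ => ?_)
      rw [sub_eq_add_neg, map_add_eq_mul, map_add_eq_mul]
      ring
    have rhs : ∑ ψ : AddChar α ℂ, c ψ * g y * ψ x = g x * g y := by
      rw [hg x, Finset.sum_mul]
      refine Finset.sum_congr rfl (fun ψ _ => ?_)
      ring
    rw [lhs, rhs, h x y]
  have := congr_fun key ψ₀
  exact (mul_left_cancel₀ hψ₀ this).symm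

/-- A non-zero solution of d'Alembert's equation takes the value `2` at `0`. [folklore] -/
theorem dAlembert_apply_zero (g : α → ℂ) (h0 : ∃ a, g a ≠ 0)
    (h : ∀ x y, g (x + y) + g (x - y) = g x * g y) : g 0 = 2 := by
  obtain ⟨ψ, hψ⟩ := exists_addChar_of_dAlembert g h0 h
  rw [hψ 0, neg_zero, map_zero_eq_one]
  norm_num

/-- The solution set of d'Alembert's equation on a finite abelian group is exactly the set of
character sums `ψ + ψ ∘ neg` (together with `g = 0`). [folklore] -/
theorem dAlembert_iff (g : α → ℂ) :
    (∀ x y, g (x + y) + g (x - y) = g x * g y) ↔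
      (g = 0 ∨ ∃ ψ : AddChar α ℂ, ∀ x, g x = ψ x + ψ (-x)) := by
  constructor
  · intro h
    by_cases h0 : ∃ a, g a ≠ 0
    · exact Or.inr (exists_addChar_of_dAlembert g h0 h)
    · push Not at h0
      exact Or.inl (funext h0)
  · rintro (rfl | ⟨ψ, hψ⟩) x y
    · simp
    · rw [hψ, hψ, hψ, hψ]
      have := dAlembert_addChar ψ x y
      simpa [sub_eq_add_neg, neg_add] using this

/-- **Multiplicative notation** (ideal class groups are written multiplicatively): a function
`g : G → ℂ` on a finite commutative group, not identically zero, with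
`g (x * y) + g (x * y⁻¹) = g x * g y`, is `x ↦ χ x + χ x⁻¹` for a homomorphism `χ : G →* ℂ`.
[folklore] -/
theorem exists_hom_of_dAlembert_mul {G : Type*} [CommGroup G] [Finite G] (g : G → ℂ)
    (h0 : ∃ a, g a ≠ 0) (h : ∀ x y, g (x * y) + g (x * y⁻¹) = g x * g y) :
    ∃ χ : G →* ℂ, ∀ x, g x = χ x + χ x⁻¹ := by
  let g' : Additive G → ℂ := fun x => g (Additive.toMul x)
  have h0' : ∃ a, g' a ≠ 0 := by
    obtain ⟨a, ha⟩ := h0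
    exact ⟨Additive.ofMul a, by simpa [g'] using ha⟩
  have h' : ∀ x y, g' (x + y) + g' (x - y) = g' x * g' y := by
    intro x y
    simpa [g', toMul_add, toMul_sub, div_eq_mul_inv] using h (Additive.toMul x) (Additive.toMul y)
  obtain ⟨ψ, hψ⟩ := exists_addChar_of_dAlembert g' h0' h'
  refine ⟨{ toFun := fun x => ψ (Additive.ofMul x),
            map_one' := by simp [map_zero_eq_one],
            map_mul' := fun x y => by simp [ofMul_mul, map_add_eq_mul] }, fun x => ?_⟩
  have := hψ (Additive.ofMul x)
  simpa [g', ofMul_inv] using this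

end Summit.RiemannHypothesis.RiemannHypothesis.Theorems.PfPersistenceBarrier.F3Hecke

end
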